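import Summits.ResolutionOfSingularities.ResolutionOfSingularities.Theorems.FrobeniusLadderFInjectiveMacaulayficationSurgeryGlue
import Summits.ResolutionOfSingularities.ResolutionOfSingularities.Theorems.FrobeniusLadderFInjectiveMacaulayficationMeasureDescent
import Summits.ResolutionOfSingularities.ResolutionOfSingularities.Theorems.FrobeniusLadderFInjectiveMacaulayficationIsoLocusTransport
import Summits.ResolutionOfSingularities.ResolutionOfSingularities.Theorems.FrobeniusLadderFInjectiveMacaulayficationBadPointsClosed
import Summits.ResolutionOfSingularities.ResolutionOfSingularities.Theorems.FrobeniusLadderFInjectiveMacaulayficationBadMaximalPoints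
import Mathlib.Data.Set.Card
import HarnessLib

/-!
# G-β — SEQUENTIAL SURGERY GLUE for closed centres (crux `FInjectiveMacaulayfication`, line `closed-centre`, hole #4-glue)

Support file for crux stmt-ResolutionOfSingularities-15315 (`FrobeniusLadder.FInjectiveMacaulayfication`), chain w45a, seat
res-L1-w45a-stub-7 (= res-D-pv-019). [OURS · L1 W4.5a] — NOT a statement of the manuscript under review; AI-written, weaker than
expert review. Ruling of record: res-L1-w45a-plan-1 R9.5 (b) (2026-08-27T05:40:20Z): the closed-centre re-cut of res-L1-w45a-strat-1
(`L/res-L1-w45a-strat-1/line-closed-centre.lean` sha16 29dfe362937dc78d) is registered only after its two glue stubs are THEOREMS;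
this file is the first of them, `stub_sequentialSurgeryGlue` ↦ `sequentialSurgeryGlue`, statement VERBATIM.

STATEMENT. Fix a field `k` of characteristic `p`. Call a pair `(X₁, f₁ : X₁ ⟶ Spec k)` ADMISSIBLE if `f₁` is separated, locally
of finite type and quasi-compact, `X₁` is integral, every stalk is Cohen–Macaulay (every system of parameters weakly regular) and
the BAD SET `{x | some parameter ideal of 𝒪_{X₁,x} is not Frobenius closed}` is finite. Hypothesis (β₄ as an implication): every
admissible pair admits, at each bad CLOSED point `b`, a non-zero ideal sheaf `J` with `b ∈ supp J` such that EVERY blowing up of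
`X₁` along `J` satisfies the full clause (domain ∧ Cohen–Macaulay ∧ parameter ideals Frobenius closed) at every point over `supp J`.
Conclusion: every admissible pair has a proper birational model with the full clause at EVERY stalk.

PROOF (folklore; the closed-centre analogue of `SurgeryGlue.stub_surgeryGlue` p157783, one blow-up at a time). Well-founded
descent on the NUMBER OF BAD POINTS (`MeasureDescent.exists_model_of_wellFounded_step` — states = admissible pairs, measure =
`Set.ncard` of the bad set, target = «no bad point»). THE STEP (`surgeryStep`): if some point is bad, it is closed
(`BadPointsClosed.stub_badPointsClosed`: a finite specialization-stable set of a Jacobson scheme consists of closed points); take the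
closed centre `J ∋ b` of the hypothesis and ANY blowing up `π : X' ⟶ X₁` along `J` (`exists_isBlowup`). Then `π` is proper
(`IsBlowup.isProper`), birational and `X'` integral (`IsBlowup.isBirational'`, `IsBlowup.isIntegral`, as `J ≠ ⊥`), so `(X', π ≫ f₁)`
is again separated / locally of finite type / quasi-compact; the stalks of `X'` are Cohen–Macaulay — over `supp J` by the hypothesis,
off `supp J` because there `π` is an isomorphism (`IsBlowup.isIso_compl`, `IsoLocusTransport.cmClause_iff_of_isIso_morphismRestrict`);
and `π` maps the bad set of `X'` INJECTIVELY (`BadMaximalPoints.eq_of_base_eq_of_isIso_morphismRestrict`) into the bad set of `X₁`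
MINUS `b` (points over `supp J` are good; off `supp J` the Frobenius clause transports, `IsoLocusTransport.fClause_iff_of_isIso_morphismRestrict`;
`b ∈ supp J`), so the bad set of `X'` is finite and strictly smaller (`Set.ncard`). The model reached when the measure is `0` has
domain stalks (it is integral), Cohen–Macaulay stalks (admissible) and no bad point. Proper and birational compose along the way
(inside `exists_model_of_wellFounded_step`).

* `surgeryStep` — the one-step construction with all admissibility data of the new pair;
* `sequentialSurgeryGlue` — strat-1's `stub_sequentialSurgeryGlue` VERBATIM, proved.

No definitions, no named facts, no `sorry`. [folklore]
-/

-- single-problem summit: the doubled namespace component is forced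
set_option linter.dupNamespace false

noncomputable section

namespace Summit.ResolutionOfSingularities.ResolutionOfSingularities.Theorems.FInjectiveMacaulayfication.SequentialSurgeryGlue

open AlgebraicGeometry CategoryTheory Literature.AlgebraicGeometry.Resolution TopologicalSpace
open Summit.ResolutionOfSingularities.ResolutionOfSingularities.Theorems.FInjectiveMacaulayfication

/-- **THE SURGERY STEP.** For an admissible pair `(X, f)` over `k` (`char k = p`) with a bad point, the hypothesis «closed centres
exist at bad closed points» yields a proper birational `π : X' ⟶ X` with `(X', π ≫ f)` admissible and STRICTLY FEWER bad points.
See the module docstring for the proof. [folklore] -/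
theorem surgeryStep (p : ℕ) (hp : p.Prime) (k : Type) [Field k] [CharP k p]
    (h4 : (∀ (X₁ : Scheme.{0}) (f₁ : X₁ ⟶ Spec (.of k)),
      IsSeparated f₁ → LocallyOfFiniteType f₁ → QuasiCompact f₁ → IsIntegral X₁ →
      (∀ x : X₁, ∀ d : ℕ, ringKrullDim (X₁.presheaf.stalk x) = d → ∀ s : Fin d → X₁.presheaf.stalk x, (Ideal.span (Set.range s)).radical.IsMaximal → RingTheory.Sequence.IsWeaklyRegular (X₁.presheaf.stalk x) (List.ofFn s)) →
      Set.Finite {x : X₁ | ¬ ∀ d : ℕ, ringKrullDim (X₁.presheaf.stalk x) = d → ∀ s : Fin d → X₁.presheaf.stalk x, (Ideal.span (Set.range s)).radical.IsMaximal → ∀ y : X₁.presheaf.stalk x, (∃ e : ℕ, y ^ p ^ e ∈ Ideal.span ((fun z : X₁.presheaf.stalk x => z ^ p ^ e) '' (Ideal.span (Set.range s) : Set (X₁.presheaf.stalk x)))) → y ∈ Ideal.span (Set.range s)} →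
      ∀ b : X₁, IsClosed ({b} : Set X₁) → (¬ ∀ d : ℕ, ringKrullDim (X₁.presheaf.stalk b) = d → ∀ s : Fin d → X₁.presheaf.stalk b, (Ideal.span (Set.range s)).radical.IsMaximal → ∀ y : X₁.presheaf.stalk b, (∃ e : ℕ, y ^ p ^ e ∈ Ideal.span ((fun z : X₁.presheaf.stalk b => z ^ p ^ e) '' (Ideal.span (Set.range s) : Set (X₁.presheaf.stalk b)))) → y ∈ Ideal.span (Set.range s)) →
      ∃ J : X₁.IdealSheafData, J ≠ ⊥ ∧ b ∈ (J.support : Set X₁) ∧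
        ∀ (X' : Scheme.{0}) (π : X' ⟶ X₁), Literature.AlgebraicGeometry.Resolution.IsBlowup π J →
          ∀ x' : X', π.base x' ∈ (J.support : Set X₁) → IsDomain (X'.presheaf.stalk x') ∧ ∀ d : ℕ, ringKrullDim (X'.presheaf.stalk x') = d → ∀ s : Fin d → X'.presheaf.stalk x', (Ideal.span (Set.range s)).radical.IsMaximal → RingTheory.Sequence.IsWeaklyRegular (X'.presheaf.stalk x') (List.ofFn s) ∧ ∀ y : X'.presheaf.stalk x', (∃ e : ℕ, y ^ p ^ e ∈ Ideal.span ((fun z : X'.presheaf.stalk x' => z ^ p ^ e) '' (Ideal.span (Set.range s) : Set (X'.presheaf.stalk x')))) → y ∈ Ideal.span (Set.range s)))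
    (X : Scheme.{0}) (f : X ⟶ Spec (.of k)) (hsep : IsSeparated f) (hft : LocallyOfFiniteType f) (hqc : QuasiCompact f)
    (hint : IsIntegral X) (hCM : ∀ x : X, ∀ d : ℕ, ringKrullDim (X.presheaf.stalk x) = d → ∀ s : Fin d → X.presheaf.stalk x, (Ideal.span (Set.range s)).radical.IsMaximal → RingTheory.Sequence.IsWeaklyRegular (X.presheaf.stalk x) (List.ofFn s))
    (hfin : Set.Finite {x : X | ¬ ∀ d : ℕ, ringKrullDim (X.presheaf.stalk x) = d → ∀ s : Fin d → X.presheaf.stalk x, (Ideal.span (Set.range s)).radical.IsMaximal → ∀ y : X.presheaf.stalk x, (∃ e : ℕ, y ^ p ^ e ∈ Ideal.span ((fun z : X.presheaf.stalk x => z ^ p ^ e) '' (Ideal.span (Set.range s) : Set (X.presheaf.stalk x)))) → y ∈ Ideal.span (Set.range s)})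
    (hbad : ∃ x : X, ¬ ∀ d : ℕ, ringKrullDim (X.presheaf.stalk x) = d → ∀ s : Fin d → X.presheaf.stalk x, (Ideal.span (Set.range s)).radical.IsMaximal → ∀ y : X.presheaf.stalk x, (∃ e : ℕ, y ^ p ^ e ∈ Ideal.span ((fun z : X.presheaf.stalk x => z ^ p ^ e) '' (Ideal.span (Set.range s) : Set (X.presheaf.stalk x)))) → y ∈ Ideal.span (Set.range s)) :
    ∃ (X' : Scheme.{0}) (π : X' ⟶ X), IsProper π ∧ IsBirational π ∧
      IsSeparated (π ≫ f) ∧ LocallyOfFiniteType (π ≫ f) ∧ QuasiCompact (π ≫ f) ∧ IsIntegral X' ∧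
      (∀ x' : X', ∀ d : ℕ, ringKrullDim (X'.presheaf.stalk x') = d → ∀ s : Fin d → X'.presheaf.stalk x', (Ideal.span (Set.range s)).radical.IsMaximal → RingTheory.Sequence.IsWeaklyRegular (X'.presheaf.stalk x') (List.ofFn s)) ∧ Set.Finite {x' : X' | ¬ ∀ d : ℕ, ringKrullDim (X'.presheaf.stalk x') = d → ∀ s : Fin d → X'.presheaf.stalk x', (Ideal.span (Set.range s)).radical.IsMaximal → ∀ y : X'.presheaf.stalk x', (∃ e : ℕ, y ^ p ^ e ∈ Ideal.span ((fun z : X'.presheaf.stalk x' => z ^ p ^ e) '' (Ideal.span (Set.range s) : Set (X'.presheaf.stalk x')))) → y ∈ Ideal.span (Set.range s)} ∧ Set.ncard {x' : X' | ¬ ∀ d : ℕ, ringKrullDim (X'.presheaf.stalk x') = d → ∀ s : Fin d → X'.presheaf.stalk x', (Ideal.span (Set.range s)).radical.IsMaximal → ∀ y : X'.presheaf.stalk x', (∃ e : ℕ, y ^ p ^ e ∈ Ideal.span ((fun z : X'.presheaf.stalk x' => z ^ p ^ e) '' (Ideal.span (Set.range s) : Set (X'.presheaf.stalk x')))) → y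 ∈ Ideal.span (Set.range s)} < Set.ncard {x : X | ¬ ∀ d : ℕ, ringKrullDim (X.presheaf.stalk x) = d → ∀ s : Fin d → X.presheaf.stalk x, (Ideal.span (Set.range s)).radical.IsMaximal → ∀ y : X.presheaf.stalk x, (∃ e : ℕ, y ^ p ^ e ∈ Ideal.span ((fun z : X.presheaf.stalk x => z ^ p ^ e) '' (Ideal.span (Set.range s) : Set (X.presheaf.stalk x)))) → y ∈ Ideal.span (Set.range s)} := by
  classical
  haveI : Fact p.Prime := ⟨hp⟩
  haveI := hsep
  haveI := hft
  haveI := hqc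
  haveI : IsLocallyNoetherian X := LocallyOfFiniteType.isLocallyNoetherian f
  -- a bad point, necessarily closed
  obtain ⟨b, hb⟩ := hbad
  have hbcl : IsClosed ({b} : Set X) := BadPointsClosed.stub_badPointsClosed p hp k X f hft hqc hCM hfin b hb
  -- the closed centre through `b` and a blowing up along it
  obtain ⟨J, hJ0, hbJ, hgood⟩ := h4 X f hsep hft hqc hint hCM hfin b hbcl hb
  obtain ⟨X', π, hπ⟩ := exists_isBlowup X J
  haveI hprop : IsProper π := hπ.isProper
  haveI : IsIntegral X' := hπ.isIntegral hJ0
  haveI : IsIso (π ∣_ centreCompl J) := hπ.isIso_compl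
  -- off the centre the blowing up is an isomorphism: membership in `centreCompl J`
  have hmemU : ∀ x' : X', π.base x' ∉ (J.support : Set X) → π.base x' ∈ centreCompl J := fun x' h => h
  -- Cohen–Macaulayness of every stalk of `X'`
  have hCM' : ∀ x' : X', ∀ d : ℕ, ringKrullDim (X'.presheaf.stalk x') = d → ∀ s : Fin d → X'.presheaf.stalk x', (Ideal.span (Set.range s)).radical.IsMaximal → RingTheory.Sequence.IsWeaklyRegular (X'.presheaf.stalk x') (List.ofFn s) := by
    intro x'
    by_cases hx' : π.base x' ∈ (J.support : Set X)
    · exact fun d hd s hs => ((hgood X' π hπ x' hx').2 d hd s hs).1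
    · exact (IsoLocusTransport.cmClause_iff_of_isIso_morphismRestrict π (centreCompl J) x' (hmemU x' hx')).mp (hCM (π.base x'))
  -- the bad set of `X'` maps injectively into the bad set of `X` minus `b`
  have hmaps : ∀ x' ∈ {x' : X' | ¬ ∀ d : ℕ, ringKrullDim (X'.presheaf.stalk x') = d → ∀ s : Fin d → X'.presheaf.stalk x', (Ideal.span (Set.range s)).radical.IsMaximal → ∀ y : X'.presheaf.stalk x', (∃ e : ℕ, y ^ p ^ e ∈ Ideal.span ((fun z : X'.presheaf.stalk x' => z ^ p ^ e) '' (Ideal.span (Set.range s) : Set (X'.presheaf.stalk x')))) → y ∈ Ideal.span (Set.range s)}, π.base x' ∈ {x : X | ¬ ∀ d : ℕ, ringKrullDim (X.presheaf.stalk x) = d → ∀ s : Fin d → X.presheaf.stalk x, (Ideal.span (Set.range s)).radical.IsMaximal → ∀ y : X.presheaf.stalk x, (∃ e : ℕ, y ^ p ^ e ∈ Ideal.span ((fun z : X.presheaf.stalk x => z ^ p ^ e) '' (Ideal.span (Set.range s) : Set (X.presheaf.stalk x)))) → y ∈ Ideal.span (Set.range s)} \ {b} := by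
    intro x' hx'
    rw [Set.mem_setOf_eq] at hx'
    have hoff : π.base x' ∉ (J.support : Set X) := fun hmem => hx' (fun d hd s hs => ((hgood X' π hπ x' hmem).2 d hd s hs).2)
    refine ⟨?_, fun hxb => hoff (by rw [Set.mem_singleton_iff.mp hxb]; exact hbJ)⟩
    rw [Set.mem_setOf_eq]
    exact fun hF => hx' ((IsoLocusTransport.fClause_iff_of_isIso_morphismRestrict p π (centreCompl J) x' (hmemU x' hoff)).mp hF)
  have hinj : Set.InjOn π.base {x' : X' | ¬ ∀ d : ℕ, ringKrullDim (X'.presheaf.stalk x') = d → ∀ s : Fin d → X'.presheaf.stalk x', (Ideal.span (Set.range s)).radical.IsMaximal → ∀ y : X'.presheaf.stalk x', (∃ e : ℕ, y ^ p ^ e ∈ Ideal.span ((fun z : X'.presheaf.stalk x' => z ^ p ^ e) '' (Ideal.span (Set.range s) : Set (X'.presheaf.stalk x')))) → y ∈ Ideal.span (Set.range s)} := by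
    intro x₁ hx₁ x₂ hx₂ h
    have h₁ : π.base x₁ ∉ (J.support : Set X) := fun hmem => by
      rw [Set.mem_setOf_eq] at hx₁; exact hx₁ (fun d hd s hs => ((hgood X' π hπ x₁ hmem).2 d hd s hs).2)
    have h₂ : π.base x₂ ∉ (J.support : Set X) := fun hmem => by
      rw [Set.mem_setOf_eq] at hx₂; exact hx₂ (fun d hd s hs => ((hgood X' π hπ x₂ hmem).2 d hd s hs).2)
    exact BadMaximalPoints.eq_of_base_eq_of_isIso_morphismRestrict π (centreCompl J) x₁ x₂ (hmemU x₁ h₁) (hmemU x₂ h₂) h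
  have hfin_diff : Set.Finite ({x : X | ¬ ∀ d : ℕ, ringKrullDim (X.presheaf.stalk x) = d → ∀ s : Fin d → X.presheaf.stalk x, (Ideal.span (Set.range s)).radical.IsMaximal → ∀ y : X.presheaf.stalk x, (∃ e : ℕ, y ^ p ^ e ∈ Ideal.span ((fun z : X.presheaf.stalk x => z ^ p ^ e) '' (Ideal.span (Set.range s) : Set (X.presheaf.stalk x)))) → y ∈ Ideal.span (Set.range s)} \ {b}) := hfin.subset Set.sdiff_subset
  have hfin' : Set.Finite {x' : X' | ¬ ∀ d : ℕ, ringKrullDim (X'.presheaf.stalk x') = d → ∀ s : Fin d → X'.presheaf.stalk x', (Ideal.span (Set.range s)).radical.IsMaximal → ∀ y : X'.presheaf.stalk x', (∃ e : ℕ, y ^ p ^ e ∈ Ideal.span ((fun z : X'.presheaf.stalk x' => z ^ p ^ e) '' (Ideal.span (Set.range s) : Set (X'.presheaf.stalk x')))) → y ∈ Ideal.span (Set.range s)} :=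
    Set.Finite.of_finite_image (hfin_diff.subset (by rintro _ ⟨x', hx', rfl⟩; exact hmaps x' hx')) hinj
  have hlt : Set.ncard {x' : X' | ¬ ∀ d : ℕ, ringKrullDim (X'.presheaf.stalk x') = d → ∀ s : Fin d → X'.presheaf.stalk x', (Ideal.span (Set.range s)).radical.IsMaximal → ∀ y : X'.presheaf.stalk x', (∃ e : ℕ, y ^ p ^ e ∈ Ideal.span ((fun z : X'.presheaf.stalk x' => z ^ p ^ e) '' (Ideal.span (Set.range s) : Set (X'.presheaf.stalk x')))) → y ∈ Ideal.span (Set.range s)} < Set.ncard {x : X | ¬ ∀ d : ℕ, ringKrullDim (X.presheaf.stalk x) = d → ∀ s : Fin d → X.presheaf.stalk x, (Ideal.span (Set.range s)).radical.IsMaximal → ∀ y : X.presheaf.stalk x, (∃ e : ℕ, y ^ p ^ e ∈ Ideal.span ((fun z : X.presheaf.stalk x => z ^ p ^ e) '' (Ideal.span (Set.range s) : Set (X.presheaf.stalk x)))) → y ∈ Ideal.span (Set.range s)} :=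
    lt_of_le_of_lt (Set.ncard_le_ncard_of_injOn π.base hmaps hinj hfin_diff)
      (Set.ncard_sdiff_singleton_lt_of_mem (by rw [Set.mem_setOf_eq]; exact hb) hfin)
  exact ⟨X', π, hprop, hπ.isBirational' hJ0, inferInstance, inferInstance, inferInstance, inferInstance, hCM', hfin', hlt⟩

/-- **G-β — SEQUENTIAL SURGERY GLUE** (strat-1's `stub_sequentialSurgeryGlue`, `L/res-L1-w45a-strat-1/line-closed-centre.lean`
sha16 29dfe362937dc78d, VERBATIM): over a fixed field of characteristic `p`, if every admissible pair with finite bad set admits at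
each bad closed point a closed centre all of whose blowing ups are good over the centre's support, then every admissible pair with
finite bad set has a proper birational model satisfying the full clause at every stalk. Proof: well-founded descent on the number
of bad points (`MeasureDescent.exists_model_of_wellFounded_step`) with `surgeryStep`. [folklore] -/
theorem sequentialSurgeryGlue : ∀ (p : ℕ), p.Prime → ∀ (k : Type) [Field k] [CharP k p],
    (∀ (X₁ : Scheme.{0}) (f₁ : X₁ ⟶ Spec (.of k)),
      IsSeparated f₁ → LocallyOfFiniteType f₁ → QuasiCompact f₁ → IsIntegral X₁ →
      (∀ x : X₁, ∀ d : ℕ, ringKrullDim (X₁.presheaf.stalk x) = d → ∀ s : Fin d → X₁.presheaf.stalk x, (Ideal.span (Set.range s)).radical.IsMaximal → RingTheory.Sequence.IsWeaklyRegular (X₁.presheaf.stalk x) (List.ofFn s)) →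
      Set.Finite {x : X₁ | ¬ ∀ d : ℕ, ringKrullDim (X₁.presheaf.stalk x) = d → ∀ s : Fin d → X₁.presheaf.stalk x, (Ideal.span (Set.range s)).radical.IsMaximal → ∀ y : X₁.presheaf.stalk x, (∃ e : ℕ, y ^ p ^ e ∈ Ideal.span ((fun z : X₁.presheaf.stalk x => z ^ p ^ e) '' (Ideal.span (Set.range s) : Set (X₁.presheaf.stalk x)))) → y ∈ Ideal.span (Set.range s)} →
      ∀ b : X₁, IsClosed ({b} : Set X₁) → (¬ ∀ d : ℕ, ringKrullDim (X₁.presheaf.stalk b) = d → ∀ s : Fin d → X₁.presheaf.stalk b, (Ideal.span (Set.range s)).radical.IsMaximal → ∀ y : X₁.presheaf.stalk b, (∃ e : ℕ, y ^ p ^ e ∈ Ideal.span ((fun z : X₁.presheaf.stalk b => z ^ p ^ e) '' (Ideal.span (Set.range s) : Set (X₁.presheaf.stalk b)))) → y ∈ Ideal.span (Set.range s)) →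
      ∃ J : X₁.IdealSheafData, J ≠ ⊥ ∧ b ∈ (J.support : Set X₁) ∧
        ∀ (X' : Scheme.{0}) (π : X' ⟶ X₁), Literature.AlgebraicGeometry.Resolution.IsBlowup π J →
          ∀ x' : X', π.base x' ∈ (J.support : Set X₁) → IsDomain (X'.presheaf.stalk x') ∧ ∀ d : ℕ, ringKrullDim (X'.presheaf.stalk x') = d → ∀ s : Fin d → X'.presheaf.stalk x', (Ideal.span (Set.range s)).radical.IsMaximal → RingTheory.Sequence.IsWeaklyRegular (X'.presheaf.stalk x') (List.ofFn s) ∧ ∀ y : X'.presheaf.stalk x', (∃ e : ℕ, y ^ p ^ e ∈ Ideal.span ((fun z : X'.presheaf.stalk x' => z ^ p ^ e) '' (Ideal.span (Set.range s) : Set (X'.presheaf.stalk x')))) → y ∈ Ideal.span (Set.range s)) →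
    ∀ (X₁ : Scheme.{0}) (f₁ : X₁ ⟶ Spec (.of k)),
    IsSeparated f₁ → LocallyOfFiniteType f₁ → QuasiCompact f₁ → IsIntegral X₁ →
    (∀ x : X₁, ∀ d : ℕ, ringKrullDim (X₁.presheaf.stalk x) = d → ∀ s : Fin d → X₁.presheaf.stalk x, (Ideal.span (Set.range s)).radical.IsMaximal → RingTheory.Sequence.IsWeaklyRegular (X₁.presheaf.stalk x) (List.ofFn s)) →
    Set.Finite {x : X₁ | ¬ ∀ d : ℕ, ringKrullDim (X₁.presheaf.stalk x) = d → ∀ s : Fin d → X₁.presheaf.stalk x, (Ideal.span (Set.range s)).radical.IsMaximal → ∀ y : X₁.presheaf.stalk x, (∃ e : ℕ, y ^ p ^ e ∈ Ideal.span ((fun z : X₁.presheaf.stalk x => z ^ p ^ e) '' (Ideal.span (Set.range s) : Set (X₁.presheaf.stalk x)))) → y ∈ Ideal.span (Set.range s)} →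
    ∃ (X' : Scheme.{0}) (π : X' ⟶ X₁), IsProper π ∧ Literature.AlgebraicGeometry.Resolution.IsBirational π ∧
      ∀ x : X', IsDomain (X'.presheaf.stalk x) ∧ ∀ d : ℕ, ringKrullDim (X'.presheaf.stalk x) = d → ∀ s : Fin d → X'.presheaf.stalk x, (Ideal.span (Set.range s)).radical.IsMaximal → RingTheory.Sequence.IsWeaklyRegular (X'.presheaf.stalk x) (List.ofFn s) ∧ ∀ y : X'.presheaf.stalk x, (∃ e : ℕ, y ^ p ^ e ∈ Ideal.span ((fun z : X'.presheaf.stalk x => z ^ p ^ e) '' (Ideal.span (Set.range s) : Set (X'.presheaf.stalk x)))) → y ∈ Ideal.span (Set.range s)  := by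
  intro p hp k _ _ h4 X₁ f₁ hsep hft hqc hint hCM hfin
  classical
  -- states = admissible pairs with finite bad set; measure = number of bad points; target = no bad point
  obtain ⟨σ', π, hπ, hbir, hP⟩ :=
    MeasureDescent.exists_model_of_wellFounded_step
      (S := {σ : Σ X : Scheme.{0}, (X ⟶ Spec (.of k)) //
        IsSeparated σ.2 ∧ LocallyOfFiniteType σ.2 ∧ QuasiCompact σ.2 ∧ IsIntegral σ.1 ∧
        (∀ x : σ.1, ∀ d : ℕ, ringKrullDim (σ.1.presheaf.stalk x) = d → ∀ s : Fin d → σ.1.presheaf.stalk x, (Ideal.span (Set.range s)).radical.IsMaximal → RingTheory.Sequence.IsWeaklyRegular (σ.1.presheaf.stalk x) (List.ofFn s)) ∧ Set.Finite {x : σ.1 | ¬ ∀ d : ℕ, ringKrullDim (σ.1.presheaf.stalk x) = d → ∀ s : Fin d → σ.1.presheaf.stalk x, (Ideal.span (Set.range s)).radical.IsMaximal → ∀ y : σ.1.presheaf.stalk x, (∃ e : ℕ, y ^ p ^ e ∈ Ideal.span ((fun z : σ.1.presheaf.stalk x => z ^ p ^ e) '' (Ideal.span (Set.range s) : Set (σ.1.presheaf.stalk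 x)))) → y ∈ Ideal.span (Set.range s)}})
      wellFounded_lt
      (fun σ => Set.ncard {x : σ.1.1 | ¬ ∀ d : ℕ, ringKrullDim (σ.1.1.presheaf.stalk x) = d → ∀ s : Fin d → σ.1.1.presheaf.stalk x, (Ideal.span (Set.range s)).radical.IsMaximal → ∀ y : σ.1.1.presheaf.stalk x, (∃ e : ℕ, y ^ p ^ e ∈ Ideal.span ((fun z : σ.1.1.presheaf.stalk x => z ^ p ^ e) '' (Ideal.span (Set.range s) : Set (σ.1.1.presheaf.stalk x)))) → y ∈ Ideal.span (Set.range s)})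
      (fun σ => σ.1.1)
      (fun σ => ∀ x : σ.1.1, ∀ d : ℕ, ringKrullDim (σ.1.1.presheaf.stalk x) = d → ∀ s : Fin d → σ.1.1.presheaf.stalk x, (Ideal.span (Set.range s)).radical.IsMaximal → ∀ y : σ.1.1.presheaf.stalk x, (∃ e : ℕ, y ^ p ^ e ∈ Ideal.span ((fun z : σ.1.1.presheaf.stalk x => z ^ p ^ e) '' (Ideal.span (Set.range s) : Set (σ.1.1.presheaf.stalk x)))) → y ∈ Ideal.span (Set.range s))
      (fun σ hσ => by
        obtain ⟨⟨X, f⟩, hs, hl, hq, hi, hc, hf⟩ := σ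
        obtain ⟨X', π, hπ, hbir, hs', hl', hq', hi', hc', hf', hlt⟩ :=
          surgeryStep p hp k h4 X f hs hl hq hi hc hf (by simpa using hσ)
        exact ⟨⟨⟨X', π ≫ f⟩, hs', hl', hq', hi', hc', hf'⟩, π, hπ, hbir, hlt⟩)
      ⟨⟨X₁, f₁⟩, hsep, hft, hqc, hint, hCM, hfin⟩
  haveI : IsIntegral σ'.1.1 := σ'.2.2.2.2.1
  exact ⟨σ'.1.1, π, hπ, hbir, fun x => ⟨inferInstance, fun d hd s hs => ⟨σ'.2.2.2.2.2.1 x d hd s hs, hP x d hd s hs⟩⟩⟩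

end Summit.ResolutionOfSingularities.ResolutionOfSingularities.Theorems.FInjectiveMacaulayfication.SequentialSurgeryGlue

end
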